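import Mathlib
import Summits.MatrixMultiplication.MatrixMultiplication.Theorems.HiddenToeplitzCornersHiddenCornerLemmaRCapacityBasic
import Summits.MatrixMultiplication.MatrixMultiplication.Theorems.HiddenToeplitzCornersHiddenCornerLemmaRCapacityKrylov
import Summits.MatrixMultiplication.MatrixMultiplication.Theorems.HiddenToeplitzCornersHiddenCornerLemmaRCapacityPoly
import Summits.MatrixMultiplication.MatrixMultiplication.Theorems.HiddenToeplitzCornersHiddenCornerLemmaRCapacityAct
import Summits.MatrixMultiplication.MatrixMultiplication.Theorems.HiddenToeplitzCornersHiddenCornerLemmaRCapacityTransport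

/-!
# (PS) the step lemma — lead's file (TEMP: toolkit lemmas restated with sorry until TK-A/B/C/D land)

Paper proof: math/STRIP_THEOREM.md §2 (PS), unified form: if `S_w = g·V_s` and `S_{w+1} = g·V_{s+1}`
then `dim Rel_{w+1}(E) ≤ dim Rel_w(E) + 1`.
-/

set_option linter.dupNamespace false

namespace Summit.MatrixMultiplication.MatrixMultiplication.Theorems

open Polynomial

variable {r : ℕ}

/-! ### `g • V_n` bookkeeping -/

section Vg

variable (g : (Polynomial ℂ))

/-- membership in `degreeLT` through `natDegree` (zero allowed). -/
theorem hclR_mem_degreeLT_iff' (p : (Polynomial ℂ)) (n : ℕ) :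
    p ∈ Polynomial.degreeLT ℂ n ↔ p = 0 ∨ p.natDegree < n := by
  rw [Polynomial.mem_degreeLT]
  by_cases hp : p = 0
  · simp [hp]
  · rw [Polynomial.degree_eq_natDegree hp]
    constructor
    · intro h; right; exact_mod_cast h
    · rintro (h | h)
      · exact absurd h hp
      · exact_mod_cast h

/-- membership in `g • degreeLT n` for multiples of `g`. -/
theorem hclR_mul_mem_VgL_iff (hg : g ≠ 0) (q : (Polynomial ℂ)) (n : ℕ) :
    g * q ∈ (Submodule.map (LinearMap.mulLeft ℂ (g : Polynomial ℂ)) (Polynomial.degreeLT ℂ (n))) ↔ q ∈ Polynomial.degreeLT ℂ n := by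
  constructor
  · intro h
    obtain ⟨q', hq', hgq⟩ := Submodule.mem_map.mp h
    have : q' = q := mul_left_cancel₀ hg (by simpa using hgq)
    rw [← this]; exact hq'
  · intro hq
    exact Submodule.mem_map.mpr ⟨q, hq, rfl⟩

/-- `g • degreeLT 0 = ⊥`. -/
theorem hclR_VgL_zero : (Submodule.map (LinearMap.mulLeft ℂ (g : Polynomial ℂ)) (Polynomial.degreeLT ℂ (0))) = ⊥ := by
  have : Polynomial.degreeLT ℂ 0 = ⊥ := by
    rw [eq_bot_iff]
    intro p hp
    rw [hclR_mem_degreeLT_iff'] at hp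
    rcases hp with h | h
    · simp [h]
    · omega
  rw [this, Submodule.map_bot]

/-- `g • degreeLT 1 = span {g}`. -/
theorem hclR_VgL_one : (Submodule.map (LinearMap.mulLeft ℂ (g : Polynomial ℂ)) (Polynomial.degreeLT ℂ (1))) = Submodule.span ℂ {g} := by
  ext x
  rw [Submodule.mem_span_singleton]
  constructor
  · intro hx
    obtain ⟨q, hq, rfl⟩ := Submodule.mem_map.mp hx
    have hq' := (hclR_mem_degreeLT_iff' q 1).mp hq
    have hq0 : q = Polynomial.C (q.coeff 0) := by
      rcases hq' with h | h
      · simp [h]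
      · exact Polynomial.eq_C_of_natDegree_eq_zero (by omega)
    refine ⟨q.coeff 0, ?_⟩
    rw [hq0]
    simp [Polynomial.smul_eq_C_mul, mul_comm]
  · rintro ⟨a, rfl⟩
    refine Submodule.mem_map.mpr ⟨Polynomial.C a, ?_, ?_⟩
    · rw [hclR_mem_degreeLT_iff']; right; simp
    · simp [Polynomial.smul_eq_C_mul, mul_comm]

/-- for `n ≥ 1`: `g • degreeLT (n+1) = g • degreeLT n ⊔ X • (g • degreeLT n)`. -/
theorem hclR_VgL_succ (n : ℕ) (hn : 1 ≤ n) :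
    (Submodule.map (LinearMap.mulLeft ℂ (g : Polynomial ℂ)) (Polynomial.degreeLT ℂ (n + 1))) = (Submodule.map (LinearMap.mulLeft ℂ (g : Polynomial ℂ)) (Polynomial.degreeLT ℂ (n))) ⊔ Submodule.map (LinearMap.mulLeft ℂ (Polynomial.X : Polynomial ℂ) : Polynomial ℂ →ₗ[ℂ] Polynomial ℂ) ((Submodule.map (LinearMap.mulLeft ℂ (g : Polynomial ℂ)) (Polynomial.degreeLT ℂ (n)))) := by
  apply le_antisymm
  · intro x hx
    obtain ⟨p, hp, rfl⟩ := Submodule.mem_map.mp hx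
    -- p = C (p.coeff 0) + X * divX p
    have hsplit : p = Polynomial.C (p.coeff 0) + X * Polynomial.divX p := by
      have := Polynomial.X_mul_divX_add p
      rw [add_comm] at this
      exact this.symm
    have hdiv : Polynomial.divX p ∈ Polynomial.degreeLT ℂ n := by
      rw [hclR_mem_degreeLT_iff'] at hp ⊢
      by_cases hd0 : Polynomial.divX p = 0
      · left; exact hd0
      · right
        have h1 : (Polynomial.divX p).natDegree = p.natDegree - 1 :=
          Polynomial.natDegree_divX_eq_natDegree_tsub_one
        rcases hp with h | h
        · exfalso; apply hd0; simp [h]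
        · omega
    have hC : Polynomial.C (p.coeff 0) ∈ Polynomial.degreeLT ℂ n := by
      rw [hclR_mem_degreeLT_iff']; right; simp; omega
    have heq : (LinearMap.mulLeft ℂ g) p =
        g * Polynomial.C (p.coeff 0) + X * (g * Polynomial.divX p) := by
      simp only [LinearMap.mulLeft_apply]
      conv_lhs => rw [hsplit]
      ring
    rw [heq]
    refine Submodule.add_mem_sup (Submodule.mem_map.mpr ⟨_, hC, rfl⟩)
      (Submodule.mem_map.mpr ⟨g * Polynomial.divX p, Submodule.mem_map.mpr ⟨_, hdiv, rfl⟩, rfl⟩)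
  · apply sup_le
    · exact Submodule.map_mono (Polynomial.degreeLT_mono (Nat.le_succ n))
    · intro x hx
      obtain ⟨y, hy, rfl⟩ := Submodule.mem_map.mp hx
      obtain ⟨q, hq, rfl⟩ := Submodule.mem_map.mp hy
      refine Submodule.mem_map.mpr ⟨X * q, ?_, ?_⟩
      · rw [hclR_mem_degreeLT_iff'] at hq ⊢
        rcases hq with h | h
        · left; simp [h]
        · right
          by_cases hq0 : q = 0
          · simp [hq0]
          · rw [Polynomial.natDegree_X_mul hq0]; omega
      · simp only [LinearMap.mulLeft_apply]; ring

/-- every nonzero element of `g • degreeLT n` has `natDegree < natDegree g + n`. -/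
theorem hclR_natDegree_lt_of_mem_VgL (hg : g ≠ 0) (x : (Polynomial ℂ)) (n : ℕ) (hx : x ∈ (Submodule.map (LinearMap.mulLeft ℂ (g : Polynomial ℂ)) (Polynomial.degreeLT ℂ (n))))
    (hx0 : x ≠ 0) : x.natDegree < g.natDegree + n := by
  obtain ⟨q, hq, rfl⟩ := Submodule.mem_map.mp hx
  simp only [LinearMap.mulLeft_apply] at hx0 ⊢
  have hq0 : q ≠ 0 := by rintro rfl; simp at hx0
  rw [Polynomial.natDegree_mul hg hq0]
  rw [hclR_mem_degreeLT_iff'] at hq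
  rcases hq with h | h
  · exact absurd h hq0
  · omega

end Vg

/-! ### (PS) assembly -/

section PS

variable (e : Fin r → (Polynomial ℂ))

/-- components of relations lie in `S`. -/
theorem hclR_comp_mem_SL (w : ℕ) (α : Fin r → (Polynomial ℂ)) (hα : α ∈ (LinearMap.ker (∑ c : Fin r, LinearMap.comp (Polynomial.lsum (fun (i : ℕ) => LinearMap.smulRight (LinearMap.id : ℂ →ₗ[ℂ] ℂ) (Polynomial.divX^[i] (e c : Polynomial ℂ))) : Polynomial ℂ →ₗ[ℂ] Polynomial ℂ) (LinearMap.proj c : (Fin r → Polynomial ℂ) →ₗ[ℂ] Polynomial ℂ)) ⊓ (Submodule.pi Set.univ (fun _ : Fin r => Polynomial.degreeLT ℂ (w)) : Submodule ℂ (Fin r → Polynomial ℂ)))) (b : Fin r) :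
    α b ∈ (⨆ b : Fin r, Submodule.map (LinearMap.proj b : (Fin r → Polynomial ℂ) →ₗ[ℂ] Polynomial ℂ) (LinearMap.ker (∑ c : Fin r, LinearMap.comp (Polynomial.lsum (fun (i : ℕ) => LinearMap.smulRight (LinearMap.id : ℂ →ₗ[ℂ] ℂ) (Polynomial.divX^[i] (e c : Polynomial ℂ))) : Polynomial ℂ →ₗ[ℂ] Polynomial ℂ) (LinearMap.proj c : (Fin r → Polynomial ℂ) →ₗ[ℂ] Polynomial ℂ)) ⊓ (Submodule.pi Set.univ (fun _ : Fin r => Polynomial.degreeLT ℂ (w)) : Submodule ℂ (Fin r → Polynomial ℂ)))) :=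
  Submodule.mem_iSup_of_mem b ⟨α, hα, rfl⟩

/-- Step 0: there is `g ≠ 0` with `S_w = g • V_s` and `S_{w+1} = g • V_{s+1}`. -/
theorem hclR_exists_g (w : ℕ)
    (hlevel : Module.finrank ℂ ↥((⨆ b : Fin r, Submodule.map (LinearMap.proj b : (Fin r → Polynomial ℂ) →ₗ[ℂ] Polynomial ℂ) (LinearMap.ker (∑ c : Fin r, LinearMap.comp (Polynomial.lsum (fun (i : ℕ) => LinearMap.smulRight (LinearMap.id : ℂ →ₗ[ℂ] ℂ) (Polynomial.divX^[i] (e c : Polynomial ℂ))) : Polynomial ℂ →ₗ[ℂ] Polynomial ℂ) (LinearMap.proj c : (Fin r → Polynomial ℂ) →ₗ[ℂ] Polynomial ℂ)) ⊓ (Submodule.pi Set.univ (fun _ : Fin r => Polynomial.degreeLT ℂ (w + 1)) : Submodule ℂ (Fin r → Polynomial ℂ))))) = Module.finrank ℂ ↥((⨆ b : Fin r, Submodule.map (LinearMap.proj b : (Fin r → Polynomial ℂ) →ₗ[ℂ] Polynomial ℂ) (LinearMap.ker (∑ c : Fin r, LinearMap.comp (Polynomial.lsum (fun (i : ℕ)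 => LinearMap.smulRight (LinearMap.id : ℂ →ₗ[ℂ] ℂ) (Polynomial.divX^[i] (e c : Polynomial ℂ))) : Polynomial ℂ →ₗ[ℂ] Polynomial ℂ) (LinearMap.proj c : (Fin r → Polynomial ℂ) →ₗ[ℂ] Polynomial ℂ)) ⊓ (Submodule.pi Set.univ (fun _ : Fin r => Polynomial.degreeLT ℂ (w)) : Submodule ℂ (Fin r → Polynomial ℂ))))) + 1) :
    ∃ g : (Polynomial ℂ), g ≠ 0 ∧ (⨆ b : Fin r, Submodule.map (LinearMap.proj b : (Fin r → Polynomial ℂ) →ₗ[ℂ] Polynomial ℂ) (LinearMap.ker (∑ c : Fin r, LinearMap.comp (Polynomial.lsum (fun (i : ℕ) => LinearMap.smulRight (LinearMap.id : ℂ →ₗ[ℂ] ℂ) (Polynomial.divX^[i] (e c : Polynomial ℂ))) : Polynomial ℂ →ₗ[ℂ] Polynomial ℂ) (LinearMap.proj c : (Fin r → Polynomial ℂ) →ₗ[ℂ] Polynomial ℂ)) ⊓ (Submodule.pi Set.univ (fun _ : Fin r => Polynomial.degreeLT ℂ (w)) : Submodule ℂ (Fin r → Polynomial ℂ)))) = (Submodule.map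 (LinearMap.mulLeft ℂ (g : Polynomial ℂ)) (Polynomial.degreeLT ℂ (Module.finrank ℂ ↥((⨆ b : Fin r, Submodule.map (LinearMap.proj b : (Fin r → Polynomial ℂ) →ₗ[ℂ] Polynomial ℂ) (LinearMap.ker (∑ c : Fin r, LinearMap.comp (Polynomial.lsum (fun (i : ℕ) => LinearMap.smulRight (LinearMap.id : ℂ →ₗ[ℂ] ℂ) (Polynomial.divX^[i] (e c : Polynomial ℂ))) : Polynomial ℂ →ₗ[ℂ] Polynomial ℂ) (LinearMap.proj c : (Fin r → Polynomial ℂ) →ₗ[ℂ] Polynomial ℂ)) ⊓ (Submodule.pi Set.univ (fun _ : Fin r => Polynomial.degreeLT ℂ (w)) : Submodule ℂ (Fin r → Polynomial ℂ)))))))) ∧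
      (⨆ b : Fin r, Submodule.map (LinearMap.proj b : (Fin r → Polynomial ℂ) →ₗ[ℂ] Polynomial ℂ) (LinearMap.ker (∑ c : Fin r, LinearMap.comp (Polynomial.lsum (fun (i : ℕ) => LinearMap.smulRight (LinearMap.id : ℂ →ₗ[ℂ] ℂ) (Polynomial.divX^[i] (e c : Polynomial ℂ))) : Polynomial ℂ →ₗ[ℂ] Polynomial ℂ) (LinearMap.proj c : (Fin r → Polynomial ℂ) →ₗ[ℂ] Polynomial ℂ)) ⊓ (Submodule.pi Set.univ (fun _ : Fin r => Polynomial.degreeLT ℂ (w + 1)) : Submodule ℂ (Fin r → Polynomial ℂ)))) = (Submodule.map (LinearMap.mulLeft ℂ (g : Polynomial ℂ)) (Polynomial.degreeLT ℂ (Module.finrank ℂ ↥((⨆ b : Fin r, Submodule.map (LinearMap.proj b : (Fin r → Polynomial ℂ) →ₗ[ℂ] Polynomial ℂ) (LinearMap.ker (∑ c : Fin r, LinearMap.comp (Polynomial.lsum (fun (i : ℕ) => LinearMap.smulRight (LinearMap.id : ℂ →ₗ[ℂ] ℂ) (Polynomial.divX^[i] (e c : Polynomial ℂ))) : Polynomial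 ℂ →ₗ[ℂ] Polynomial ℂ) (LinearMap.proj c : (Fin r → Polynomial ℂ) →ₗ[ℂ] Polynomial ℂ)) ⊓ (Submodule.pi Set.univ (fun _ : Fin r => Polynomial.degreeLT ℂ (w)) : Submodule ℂ (Fin r → Polynomial ℂ))))) + 1))) := by
  haveI := hclR_fd_SL e w
  haveI := hclR_fd_SL e (w + 1)
  set s := Module.finrank ℂ ↥((⨆ b : Fin r, Submodule.map (LinearMap.proj b : (Fin r → Polynomial ℂ) →ₗ[ℂ] Polynomial ℂ) (LinearMap.ker (∑ c : Fin r, LinearMap.comp (Polynomial.lsum (fun (i : ℕ) => LinearMap.smulRight (LinearMap.id : ℂ →ₗ[ℂ] ℂ) (Polynomial.divX^[i] (e c : Polynomial ℂ))) : Polynomial ℂ →ₗ[ℂ] Polynomial ℂ) (LinearMap.proj c : (Fin r → Polynomial ℂ) →ₗ[ℂ] Polynomial ℂ)) ⊓ (Submodule.pi Set.univ (fun _ : Fin r => Polynomial.degreeLT ℂ (w)) : Submodule ℂ (Fin r → Polynomial ℂ))))) with hs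
  rcases Nat.eq_zero_or_pos s with hs0 | hspos
  · -- s = 0 : S_w = ⊥ and S_{w+1} is a line
    have hSw : (⨆ b : Fin r, Submodule.map (LinearMap.proj b : (Fin r → Polynomial ℂ) →ₗ[ℂ] Polynomial ℂ) (LinearMap.ker (∑ c : Fin r, LinearMap.comp (Polynomial.lsum (fun (i : ℕ) => LinearMap.smulRight (LinearMap.id : ℂ →ₗ[ℂ] ℂ) (Polynomial.divX^[i] (e c : Polynomial ℂ))) : Polynomial ℂ →ₗ[ℂ] Polynomial ℂ) (LinearMap.proj c : (Fin r → Polynomial ℂ) →ₗ[ℂ] Polynomial ℂ)) ⊓ (Submodule.pi Set.univ (fun _ : Fin r => Polynomial.degreeLT ℂ (w)) : Submodule ℂ (Fin r → Polynomial ℂ)))) = ⊥ := Submodule.finrank_eq_zero.mp (by rw [← hs, hs0])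
    have hne : (⨆ b : Fin r, Submodule.map (LinearMap.proj b : (Fin r → Polynomial ℂ) →ₗ[ℂ] Polynomial ℂ) (LinearMap.ker (∑ c : Fin r, LinearMap.comp (Polynomial.lsum (fun (i : ℕ) => LinearMap.smulRight (LinearMap.id : ℂ →ₗ[ℂ] ℂ) (Polynomial.divX^[i] (e c : Polynomial ℂ))) : Polynomial ℂ →ₗ[ℂ] Polynomial ℂ) (LinearMap.proj c : (Fin r → Polynomial ℂ) →ₗ[ℂ] Polynomial ℂ)) ⊓ (Submodule.pi Set.univ (fun _ : Fin r => Polynomial.degreeLT ℂ (w + 1)) : Submodule ℂ (Fin r → Polynomial ℂ)))) ≠ ⊥ := by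
      intro h
      rw [h, finrank_bot] at hlevel
      omega
    obtain ⟨g, hgmem, hg0⟩ := Submodule.exists_mem_ne_zero_of_ne_bot hne
    refine ⟨g, hg0, ?_, ?_⟩
    · rw [hs0, hclR_VgL_zero, hSw]
    · rw [hs0, zero_add, hclR_VgL_one]
      symm
      apply Submodule.eq_of_le_of_finrank_eq
      · rw [Submodule.span_le, Set.singleton_subset_iff]; exact hgmem
      · rw [finrank_span_singleton hg0, hlevel, hs0]
  · -- s ≥ 1 : structure lemma (P2) applied to S_w
    have hne : (⨆ b : Fin r, Submodule.map (LinearMap.proj b : (Fin r → Polynomial ℂ) →ₗ[ℂ] Polynomial ℂ) (LinearMap.ker (∑ c : Fin r, LinearMap.comp (Polynomial.lsum (fun (i : ℕ) => LinearMap.smulRight (LinearMap.id : ℂ →ₗ[ℂ] ℂ) (Polynomial.divX^[i] (e c : Polynomial ℂ))) : Polynomial ℂ →ₗ[ℂ] Polynomial ℂ) (LinearMap.proj c : (Fin r → Polynomial ℂ) →ₗ[ℂ] Polynomial ℂ)) ⊓ (Submodule.pi Set.univ (fun _ : Fin r => Polynomial.degreeLT ℂ (w)) : Submodule ℂ (Fin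 r → Polynomial ℂ)))) ≠ ⊥ := by
      intro h; rw [h, finrank_bot] at hs; omega
    have hsup_le : (⨆ b : Fin r, Submodule.map (LinearMap.proj b : (Fin r → Polynomial ℂ) →ₗ[ℂ] Polynomial ℂ) (LinearMap.ker (∑ c : Fin r, LinearMap.comp (Polynomial.lsum (fun (i : ℕ) => LinearMap.smulRight (LinearMap.id : ℂ →ₗ[ℂ] ℂ) (Polynomial.divX^[i] (e c : Polynomial ℂ))) : Polynomial ℂ →ₗ[ℂ] Polynomial ℂ) (LinearMap.proj c : (Fin r → Polynomial ℂ) →ₗ[ℂ] Polynomial ℂ)) ⊓ (Submodule.pi Set.univ (fun _ : Fin r => Polynomial.degreeLT ℂ (w)) : Submodule ℂ (Fin r → Polynomial ℂ)))) ⊔ Submodule.map (LinearMap.mulLeft ℂ (Polynomial.X : Polynomial ℂ) : Polynomial ℂ →ₗ[ℂ] Polynomial ℂ) ((⨆ b : Fin r, Submodule.map (LinearMap.proj b : (Fin r → Polynomial ℂ) →ₗ[ℂ] Polynomial ℂ) (LinearMap.ker (∑ c : Fin r, LinearMap.comp (Polynomial.lsum (fun (i : ℕ) => LinearMap.smulRight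 (LinearMap.id : ℂ →ₗ[ℂ] ℂ) (Polynomial.divX^[i] (e c : Polynomial ℂ))) : Polynomial ℂ →ₗ[ℂ] Polynomial ℂ) (LinearMap.proj c : (Fin r → Polynomial ℂ) →ₗ[ℂ] Polynomial ℂ)) ⊓ (Submodule.pi Set.univ (fun _ : Fin r => Polynomial.degreeLT ℂ (w)) : Submodule ℂ (Fin r → Polynomial ℂ))))) ≤ (⨆ b : Fin r, Submodule.map (LinearMap.proj b : (Fin r → Polynomial ℂ) →ₗ[ℂ] Polynomial ℂ) (LinearMap.ker (∑ c : Fin r, LinearMap.comp (Polynomial.lsum (fun (i : ℕ) => LinearMap.smulRight (LinearMap.id : ℂ →ₗ[ℂ] ℂ) (Polynomial.divX^[i] (e c : Polynomial ℂ))) : Polynomial ℂ →ₗ[ℂ] Polynomial ℂ) (LinearMap.proj c : (Fin r → Polynomial ℂ) →ₗ[ℂ] Polynomial ℂ)) ⊓ (Submodule.pi Set.univ (fun _ : Fin r => Polynomial.degreeLT ℂ (w + 1)) : Submodule ℂ (Fin r → Polynomial ℂ)))) :=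
      hclR_SL_sup_X_mul_le e w
    haveI : FiniteDimensional ℂ ↥((⨆ b : Fin r, Submodule.map (LinearMap.proj b : (Fin r → Polynomial ℂ) →ₗ[ℂ] Polynomial ℂ) (LinearMap.ker (∑ c : Fin r, LinearMap.comp (Polynomial.lsum (fun (i : ℕ) => LinearMap.smulRight (LinearMap.id : ℂ →ₗ[ℂ] ℂ) (Polynomial.divX^[i] (e c : Polynomial ℂ))) : Polynomial ℂ →ₗ[ℂ] Polynomial ℂ) (LinearMap.proj c : (Fin r → Polynomial ℂ) →ₗ[ℂ] Polynomial ℂ)) ⊓ (Submodule.pi Set.univ (fun _ : Fin r => Polynomial.degreeLT ℂ (w)) : Submodule ℂ (Fin r → Polynomial ℂ)))) ⊔ Submodule.map (LinearMap.mulLeft ℂ (Polynomial.X : Polynomial ℂ) : Polynomial ℂ →ₗ[ℂ] Polynomial ℂ) ((⨆ b : Fin r, Submodule.map (LinearMap.proj b : (Fin r → Polynomial ℂ) →ₗ[ℂ] Polynomial ℂ) (LinearMap.ker (∑ c : Fin r, LinearMap.comp (Polynomial.lsum (fun (i : ℕ) => LinearMap.smulRight (LinearMap.id : ℂ →ₗ[ℂ]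 ℂ) (Polynomial.divX^[i] (e c : Polynomial ℂ))) : Polynomial ℂ →ₗ[ℂ] Polynomial ℂ) (LinearMap.proj c : (Fin r → Polynomial ℂ) →ₗ[ℂ] Polynomial ℂ)) ⊓ (Submodule.pi Set.univ (fun _ : Fin r => Polynomial.degreeLT ℂ (w)) : Submodule ℂ (Fin r → Polynomial ℂ)))))) :=
      Submodule.finiteDimensional_of_le hsup_le
    have hlt : (⨆ b : Fin r, Submodule.map (LinearMap.proj b : (Fin r → Polynomial ℂ) →ₗ[ℂ] Polynomial ℂ) (LinearMap.ker (∑ c : Fin r, LinearMap.comp (Polynomial.lsum (fun (i : ℕ) => LinearMap.smulRight (LinearMap.id : ℂ →ₗ[ℂ] ℂ) (Polynomial.divX^[i] (e c : Polynomial ℂ))) : Polynomial ℂ →ₗ[ℂ] Polynomial ℂ) (LinearMap.proj c : (Fin r → Polynomial ℂ) →ₗ[ℂ] Polynomial ℂ)) ⊓ (Submodule.pi Set.univ (fun _ : Fin r => Polynomial.degreeLT ℂ (w)) : Submodule ℂ (Fin r → Polynomial ℂ)))) < (⨆ b : Fin r, Submodule.map (LinearMap.proj b : (Fin r → Polynomial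 ℂ) →ₗ[ℂ] Polynomial ℂ) (LinearMap.ker (∑ c : Fin r, LinearMap.comp (Polynomial.lsum (fun (i : ℕ) => LinearMap.smulRight (LinearMap.id : ℂ →ₗ[ℂ] ℂ) (Polynomial.divX^[i] (e c : Polynomial ℂ))) : Polynomial ℂ →ₗ[ℂ] Polynomial ℂ) (LinearMap.proj c : (Fin r → Polynomial ℂ) →ₗ[ℂ] Polynomial ℂ)) ⊓ (Submodule.pi Set.univ (fun _ : Fin r => Polynomial.degreeLT ℂ (w)) : Submodule ℂ (Fin r → Polynomial ℂ)))) ⊔ Submodule.map (LinearMap.mulLeft ℂ (Polynomial.X : Polynomial ℂ) : Polynomial ℂ →ₗ[ℂ] Polynomial ℂ) ((⨆ b : Fin r, Submodule.map (LinearMap.proj b : (Fin r → Polynomial ℂ) →ₗ[ℂ] Polynomial ℂ) (LinearMap.ker (∑ c : Fin r, LinearMap.comp (Polynomial.lsum (fun (i : ℕ) => LinearMap.smulRight (LinearMap.id : ℂ →ₗ[ℂ] ℂ) (Polynomial.divX^[i] (e c : Polynomial ℂ))) : Polynomial ℂ →ₗ[ℂ] Polynomial ℂ) (LinearMap.proj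 c : (Fin r → Polynomial ℂ) →ₗ[ℂ] Polynomial ℂ)) ⊓ (Submodule.pi Set.univ (fun _ : Fin r => Polynomial.degreeLT ℂ (w)) : Submodule ℂ (Fin r → Polynomial ℂ))))) := by
      refine lt_of_le_of_ne le_sup_left ?_
      intro heq
      apply hclR_not_X_mul_stable e ((⨆ b : Fin r, Submodule.map (LinearMap.proj b : (Fin r → Polynomial ℂ) →ₗ[ℂ] Polynomial ℂ) (LinearMap.ker (∑ c : Fin r, LinearMap.comp (Polynomial.lsum (fun (i : ℕ) => LinearMap.smulRight (LinearMap.id : ℂ →ₗ[ℂ] ℂ) (Polynomial.divX^[i] (e c : Polynomial ℂ))) : Polynomial ℂ →ₗ[ℂ] Polynomial ℂ) (LinearMap.proj c : (Fin r → Polynomial ℂ) →ₗ[ℂ] Polynomial ℂ)) ⊓ (Submodule.pi Set.univ (fun _ : Fin r => Polynomial.degreeLT ℂ (w)) : Submodule ℂ (Fin r → Polynomial ℂ))))) hne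
      calc Submodule.map (LinearMap.mulLeft ℂ (Polynomial.X : Polynomial ℂ) : Polynomial ℂ →ₗ[ℂ] Polynomial ℂ) ((⨆ b : Fin r, Submodule.map (LinearMap.proj b : (Fin r → Polynomial ℂ) →ₗ[ℂ] Polynomial ℂ) (LinearMap.ker (∑ c : Fin r, LinearMap.comp (Polynomial.lsum (fun (i : ℕ) => LinearMap.smulRight (LinearMap.id : ℂ →ₗ[ℂ] ℂ) (Polynomial.divX^[i] (e c : Polynomial ℂ))) : Polynomial ℂ →ₗ[ℂ] Polynomial ℂ) (LinearMap.proj c : (Fin r → Polynomial ℂ) →ₗ[ℂ] Polynomial ℂ)) ⊓ (Submodule.pi Set.univ (fun _ : Fin r => Polynomial.degreeLT ℂ (w)) : Submodule ℂ (Fin r → Polynomial ℂ))))) ≤ (⨆ b : Fin r, Submodule.map (LinearMap.proj b : (Fin r → Polynomial ℂ) →ₗ[ℂ] Polynomial ℂ) (LinearMap.ker (∑ c : Fin r, LinearMap.comp (Polynomial.lsum (fun (i : ℕ) => LinearMap.smulRight (LinearMap.id : ℂ →ₗ[ℂ] ℂ) (Polynomial.divX^[i] (e c : Polynomial ℂ)))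 : Polynomial ℂ →ₗ[ℂ] Polynomial ℂ) (LinearMap.proj c : (Fin r → Polynomial ℂ) →ₗ[ℂ] Polynomial ℂ)) ⊓ (Submodule.pi Set.univ (fun _ : Fin r => Polynomial.degreeLT ℂ (w)) : Submodule ℂ (Fin r → Polynomial ℂ)))) ⊔ Submodule.map (LinearMap.mulLeft ℂ (Polynomial.X : Polynomial ℂ) : Polynomial ℂ →ₗ[ℂ] Polynomial ℂ) ((⨆ b : Fin r, Submodule.map (LinearMap.proj b : (Fin r → Polynomial ℂ) →ₗ[ℂ] Polynomial ℂ) (LinearMap.ker (∑ c : Fin r, LinearMap.comp (Polynomial.lsum (fun (i : ℕ) => LinearMap.smulRight (LinearMap.id : ℂ →ₗ[ℂ] ℂ) (Polynomial.divX^[i] (e c : Polynomial ℂ))) : Polynomial ℂ →ₗ[ℂ] Polynomial ℂ) (LinearMap.proj c : (Fin r → Polynomial ℂ) →ₗ[ℂ] Polynomial ℂ)) ⊓ (Submodule.pi Set.univ (fun _ : Fin r => Polynomial.degreeLT ℂ (w)) : Submodule ℂ (Fin r → Polynomial ℂ))))) :=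
            le_sup_right
        _ = (⨆ b : Fin r, Submodule.map (LinearMap.proj b : (Fin r → Polynomial ℂ) →ₗ[ℂ] Polynomial ℂ) (LinearMap.ker (∑ c : Fin r, LinearMap.comp (Polynomial.lsum (fun (i : ℕ) => LinearMap.smulRight (LinearMap.id : ℂ →ₗ[ℂ] ℂ) (Polynomial.divX^[i] (e c : Polynomial ℂ))) : Polynomial ℂ →ₗ[ℂ] Polynomial ℂ) (LinearMap.proj c : (Fin r → Polynomial ℂ) →ₗ[ℂ] Polynomial ℂ)) ⊓ (Submodule.pi Set.univ (fun _ : Fin r => Polynomial.degreeLT ℂ (w)) : Submodule ℂ (Fin r → Polynomial ℂ)))) := heq.symm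
    have h1 := Submodule.finrank_lt_finrank_of_lt hlt
    have h2 := Submodule.finrank_mono hsup_le
    have hfin : Module.finrank ℂ ↥((⨆ b : Fin r, Submodule.map (LinearMap.proj b : (Fin r → Polynomial ℂ) →ₗ[ℂ] Polynomial ℂ) (LinearMap.ker (∑ c : Fin r, LinearMap.comp (Polynomial.lsum (fun (i : ℕ) => LinearMap.smulRight (LinearMap.id : ℂ →ₗ[ℂ] ℂ) (Polynomial.divX^[i] (e c : Polynomial ℂ))) : Polynomial ℂ →ₗ[ℂ] Polynomial ℂ) (LinearMap.proj c : (Fin r → Polynomial ℂ) →ₗ[ℂ] Polynomial ℂ)) ⊓ (Submodule.pi Set.univ (fun _ : Fin r => Polynomial.degreeLT ℂ (w)) : Submodule ℂ (Fin r → Polynomial ℂ)))) ⊔ Submodule.map (LinearMap.mulLeft ℂ (Polynomial.X : Polynomial ℂ) : Polynomial ℂ →ₗ[ℂ] Polynomial ℂ) ((⨆ b : Fin r, Submodule.map (LinearMap.proj b : (Fin r → Polynomial ℂ) →ₗ[ℂ] Polynomial ℂ) (LinearMap.ker (∑ c : Fin r, LinearMap.comp (Polynomial.lsum (fun (i : ℕ)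 => LinearMap.smulRight (LinearMap.id : ℂ →ₗ[ℂ] ℂ) (Polynomial.divX^[i] (e c : Polynomial ℂ))) : Polynomial ℂ →ₗ[ℂ] Polynomial ℂ) (LinearMap.proj c : (Fin r → Polynomial ℂ) →ₗ[ℂ] Polynomial ℂ)) ⊓ (Submodule.pi Set.univ (fun _ : Fin r => Polynomial.degreeLT ℂ (w)) : Submodule ℂ (Fin r → Polynomial ℂ)))))) = s + 1 := by
      rw [hlevel] at h2; omega
    obtain ⟨g, hg0, hSg⟩ := hclR_X_mul_growth_one e ((⨆ b : Fin r, Submodule.map (LinearMap.proj b : (Fin r → Polynomial ℂ) →ₗ[ℂ] Polynomial ℂ) (LinearMap.ker (∑ c : Fin r, LinearMap.comp (Polynomial.lsum (fun (i : ℕ) => LinearMap.smulRight (LinearMap.id : ℂ →ₗ[ℂ] ℂ) (Polynomial.divX^[i] (e c : Polynomial ℂ))) : Polynomial ℂ →ₗ[ℂ] Polynomial ℂ) (LinearMap.proj c : (Fin r → Polynomial ℂ) →ₗ[ℂ] Polynomial ℂ)) ⊓ (Submodule.pi Set.univ (fun _ : Fin r => Polynomial.degreeLT ℂ (w)) : Submodule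 ℂ (Fin r → Polynomial ℂ))))) hne hfin
    refine ⟨g, hg0, hSg, ?_⟩
    have heq : (⨆ b : Fin r, Submodule.map (LinearMap.proj b : (Fin r → Polynomial ℂ) →ₗ[ℂ] Polynomial ℂ) (LinearMap.ker (∑ c : Fin r, LinearMap.comp (Polynomial.lsum (fun (i : ℕ) => LinearMap.smulRight (LinearMap.id : ℂ →ₗ[ℂ] ℂ) (Polynomial.divX^[i] (e c : Polynomial ℂ))) : Polynomial ℂ →ₗ[ℂ] Polynomial ℂ) (LinearMap.proj c : (Fin r → Polynomial ℂ) →ₗ[ℂ] Polynomial ℂ)) ⊓ (Submodule.pi Set.univ (fun _ : Fin r => Polynomial.degreeLT ℂ (w)) : Submodule ℂ (Fin r → Polynomial ℂ)))) ⊔ Submodule.map (LinearMap.mulLeft ℂ (Polynomial.X : Polynomial ℂ) : Polynomial ℂ →ₗ[ℂ] Polynomial ℂ) ((⨆ b : Fin r, Submodule.map (LinearMap.proj b : (Fin r → Polynomial ℂ) →ₗ[ℂ] Polynomial ℂ) (LinearMap.ker (∑ c : Fin r, LinearMap.comp (Polynomial.lsum (fun (i : ℕ) => LinearMap.smulRight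 (LinearMap.id : ℂ →ₗ[ℂ] ℂ) (Polynomial.divX^[i] (e c : Polynomial ℂ))) : Polynomial ℂ →ₗ[ℂ] Polynomial ℂ) (LinearMap.proj c : (Fin r → Polynomial ℂ) →ₗ[ℂ] Polynomial ℂ)) ⊓ (Submodule.pi Set.univ (fun _ : Fin r => Polynomial.degreeLT ℂ (w)) : Submodule ℂ (Fin r → Polynomial ℂ))))) = (⨆ b : Fin r, Submodule.map (LinearMap.proj b : (Fin r → Polynomial ℂ) →ₗ[ℂ] Polynomial ℂ) (LinearMap.ker (∑ c : Fin r, LinearMap.comp (Polynomial.lsum (fun (i : ℕ) => LinearMap.smulRight (LinearMap.id : ℂ →ₗ[ℂ] ℂ) (Polynomial.divX^[i] (e c : Polynomial ℂ))) : Polynomial ℂ →ₗ[ℂ] Polynomial ℂ) (LinearMap.proj c : (Fin r → Polynomial ℂ) →ₗ[ℂ] Polynomial ℂ)) ⊓ (Submodule.pi Set.univ (fun _ : Fin r => Polynomial.degreeLT ℂ (w + 1)) : Submodule ℂ (Fin r → Polynomial ℂ)))) :=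
      Submodule.eq_of_le_of_finrank_eq hsup_le (by rw [hfin, hlevel])
    rw [← heq, hclR_VgL_succ g s hspos, ← hSg]

/-- **(PS) — the step lemma** (paper: STRIP_THEOREM §2). For an independent frame of `r ≥ 2`
polynomials: if the capacity is level and positive between windows `w` and `w+1`
(`dim S_{w+1} = dim S_w + 1`, `dim S_w < w`) then the Krylov dimension jumps by at least `r - 1`:
`κ_w + r ≤ κ_{w+1} + 1`. -/
theorem hclR_step_lemma' (w : ℕ)
    (hlevel : Module.finrank ℂ ↥((⨆ b : Fin r, Submodule.map (LinearMap.proj b : (Fin r → Polynomial ℂ) →ₗ[ℂ] Polynomial ℂ) (LinearMap.ker (∑ c : Fin r, LinearMap.comp (Polynomial.lsum (fun (i : ℕ) => LinearMap.smulRight (LinearMap.id : ℂ →ₗ[ℂ] ℂ) (Polynomial.divX^[i] (e c : Polynomial ℂ))) : Polynomial ℂ →ₗ[ℂ] Polynomial ℂ) (LinearMap.proj c : (Fin r → Polynomial ℂ) →ₗ[ℂ] Polynomial ℂ)) ⊓ (Submodule.pi Set.univ (fun _ : Fin r => Polynomial.degreeLT ℂ (w + 1)) : Submodule ℂ (Fin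 r → Polynomial ℂ))))) = Module.finrank ℂ ↥((⨆ b : Fin r, Submodule.map (LinearMap.proj b : (Fin r → Polynomial ℂ) →ₗ[ℂ] Polynomial ℂ) (LinearMap.ker (∑ c : Fin r, LinearMap.comp (Polynomial.lsum (fun (i : ℕ) => LinearMap.smulRight (LinearMap.id : ℂ →ₗ[ℂ] ℂ) (Polynomial.divX^[i] (e c : Polynomial ℂ))) : Polynomial ℂ →ₗ[ℂ] Polynomial ℂ) (LinearMap.proj c : (Fin r → Polynomial ℂ) →ₗ[ℂ] Polynomial ℂ)) ⊓ (Submodule.pi Set.univ (fun _ : Fin r => Polynomial.degreeLT ℂ (w)) : Submodule ℂ (Fin r → Polynomial ℂ))))) + 1)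
    (hpos : Module.finrank ℂ ↥((⨆ b : Fin r, Submodule.map (LinearMap.proj b : (Fin r → Polynomial ℂ) →ₗ[ℂ] Polynomial ℂ) (LinearMap.ker (∑ c : Fin r, LinearMap.comp (Polynomial.lsum (fun (i : ℕ) => LinearMap.smulRight (LinearMap.id : ℂ →ₗ[ℂ] ℂ) (Polynomial.divX^[i] (e c : Polynomial ℂ))) : Polynomial ℂ →ₗ[ℂ] Polynomial ℂ) (LinearMap.proj c : (Fin r → Polynomial ℂ) →ₗ[ℂ] Polynomial ℂ)) ⊓ (Submodule.pi Set.univ (fun _ : Fin r => Polynomial.degreeLT ℂ (w)) : Submodule ℂ (Fin r → Polynomial ℂ))))) < w) :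
    Module.finrank ℂ ↥((Submodule.span ℂ (Set.range (fun p : Fin (r) × Fin (w) => Polynomial.divX^[(Prod.snd p).val] ((e : Fin r → Polynomial ℂ) (Prod.fst p)))))) + r ≤ Module.finrank ℂ ↥((Submodule.span ℂ (Set.range (fun p : Fin (r) × Fin (w + 1) => Polynomial.divX^[(Prod.snd p).val] ((e : Fin r → Polynomial ℂ) (Prod.fst p)))))) + 1 := by
  haveI := hclR_fd_SL e w
  haveI := hclR_fd_SL e (w + 1)
  haveI := hclR_fd_degreeLT (w + 1)
  set s := Module.finrank ℂ ↥((⨆ b : Fin r, Submodule.map (LinearMap.proj b : (Fin r → Polynomial ℂ) →ₗ[ℂ] Polynomial ℂ) (LinearMap.ker (∑ c : Fin r, LinearMap.comp (Polynomial.lsum (fun (i : ℕ) => LinearMap.smulRight (LinearMap.id : ℂ →ₗ[ℂ] ℂ) (Polynomial.divX^[i] (e c : Polynomial ℂ))) : Polynomial ℂ →ₗ[ℂ] Polynomial ℂ) (LinearMap.proj c : (Fin r → Polynomial ℂ) →ₗ[ℂ] Polynomial ℂ)) ⊓ (Submodule.pi Set.univ (fun _ : Fin r => Polynomial.degreeLT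 ℂ (w)) : Submodule ℂ (Fin r → Polynomial ℂ))))) with hs
  -- Step 0
  obtain ⟨g, hg0, hSw, hSw1⟩ := hclR_exists_g e w hlevel
  set γ := g.natDegree with hγ
  set v := g.natTrailingDegree with hv
  have hvγ : v ≤ γ := Polynomial.natTrailingDegree_le_natDegree g
  -- Step 1: γ + s ≤ w  (g X^s ∈ S_{w+1} ≤ degreeLT (w+1))
  have hγs : γ + s ≤ w := by
    have hmem : g * X ^ s ∈ (⨆ b : Fin r, Submodule.map (LinearMap.proj b : (Fin r → Polynomial ℂ) →ₗ[ℂ] Polynomial ℂ) (LinearMap.ker (∑ c : Fin r, LinearMap.comp (Polynomial.lsum (fun (i : ℕ) => LinearMap.smulRight (LinearMap.id : ℂ →ₗ[ℂ] ℂ) (Polynomial.divX^[i] (e c : Polynomial ℂ))) : Polynomial ℂ →ₗ[ℂ] Polynomial ℂ) (LinearMap.proj c : (Fin r → Polynomial ℂ) →ₗ[ℂ] Polynomial ℂ)) ⊓ (Submodule.pi Set.univ (fun _ : Fin r => Polynomial.degreeLT ℂ (w + 1)) : Submodule ℂ (Fin r → Polynomial ℂ)))) := by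
      rw [hSw1]
      exact (hclR_mul_mem_VgL_iff g hg0 (X ^ s) (s + 1)).mpr (by
        rw [hclR_mem_degreeLT_iff']; right; simp)
    have hdeg := hclR_SL_le_degreeLT e (w + 1) hmem
    rw [hclR_mem_degreeLT_iff'] at hdeg
    rcases hdeg with h | h
    · exfalso; exact (mul_ne_zero hg0 (pow_ne_zero s Polynomial.X_ne_zero)) h
    · rw [Polynomial.natDegree_mul hg0 (pow_ne_zero s Polynomial.X_ne_zero),
        Polynomial.natDegree_X_pow] at h
      omega
  -- Step 2: transport of dimensions to the shifted frame e' = divX^[v] ∘ e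
  have hD1 : Module.finrank ℂ ↥((LinearMap.ker (∑ c : Fin r, LinearMap.comp (Polynomial.lsum (fun (i : ℕ) => LinearMap.smulRight (LinearMap.id : ℂ →ₗ[ℂ] ℂ) (Polynomial.divX^[i] (e c : Polynomial ℂ))) : Polynomial ℂ →ₗ[ℂ] Polynomial ℂ) (LinearMap.proj c : (Fin r → Polynomial ℂ) →ₗ[ℂ] Polynomial ℂ)) ⊓ (Submodule.pi Set.univ (fun _ : Fin r => Polynomial.degreeLT ℂ (w + 1)) : Submodule ℂ (Fin r → Polynomial ℂ)))) = Module.finrank ℂ ↥((LinearMap.ker (∑ c : Fin r, LinearMap.comp (Polynomial.lsum (fun (i : ℕ) => LinearMap.smulRight (LinearMap.id : ℂ →ₗ[ℂ] ℂ) (Polynomial.divX^[i] ((fun c : Fin r => Polynomial.divX^[(g : Polynomial ℂ).natTrailingDegree] ((e : Fin r → Polynomial ℂ) c)) c : Polynomial ℂ))) : Polynomial ℂ →ₗ[ℂ] Polynomial ℂ) (LinearMap.proj c : (Fin r → Polynomial ℂ) →ₗ[ℂ] Polynomial ℂ)) ⊓ (Submodule.pi Set.univ (fun _ : Fin r =>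 Polynomial.degreeLT ℂ (s + 1)) : Submodule ℂ (Fin r → Polynomial ℂ)))) :=
    hclR_finrank_transport' e g hg0 (s + 1) (w + 1) (by omega) (by
      intro α hα c
      have := hclR_comp_mem_SL e (w + 1) α hα c
      rwa [hSw1] at this)
  have hD0 : Module.finrank ℂ ↥((LinearMap.ker (∑ c : Fin r, LinearMap.comp (Polynomial.lsum (fun (i : ℕ) => LinearMap.smulRight (LinearMap.id : ℂ →ₗ[ℂ] ℂ) (Polynomial.divX^[i] (e c : Polynomial ℂ))) : Polynomial ℂ →ₗ[ℂ] Polynomial ℂ) (LinearMap.proj c : (Fin r → Polynomial ℂ) →ₗ[ℂ] Polynomial ℂ)) ⊓ (Submodule.pi Set.univ (fun _ : Fin r => Polynomial.degreeLT ℂ (w)) : Submodule ℂ (Fin r → Polynomial ℂ)))) = Module.finrank ℂ ↥((LinearMap.ker (∑ c : Fin r, LinearMap.comp (Polynomial.lsum (fun (i : ℕ) => LinearMap.smulRight (LinearMap.id : ℂ →ₗ[ℂ] ℂ) (Polynomial.divX^[i] ((fun c : Fin r => Polynomial.divX^[(g : Polynomial ℂ).natTrailingDegree] ((e : Fin r →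 Polynomial ℂ) c)) c : Polynomial ℂ))) : Polynomial ℂ →ₗ[ℂ] Polynomial ℂ) (LinearMap.proj c : (Fin r → Polynomial ℂ) →ₗ[ℂ] Polynomial ℂ)) ⊓ (Submodule.pi Set.univ (fun _ : Fin r => Polynomial.degreeLT ℂ (s)) : Submodule ℂ (Fin r → Polynomial ℂ)))) :=
    hclR_finrank_transport' e g hg0 s w (by omega) (by
      intro α hα c
      have := hclR_comp_mem_SL e w α hα c
      rwa [hSw] at this)
  -- Step 3: γ + s = w (the X-escape argument)
  have hγs' : γ + s = w := by
    by_contra hne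
    have hlt : γ + s + 1 ≤ w := by omega
    -- a relation in Rel_{w+1} with a component outside g • V_s
    have hex : ∃ α ∈ (LinearMap.ker (∑ c : Fin r, LinearMap.comp (Polynomial.lsum (fun (i : ℕ) => LinearMap.smulRight (LinearMap.id : ℂ →ₗ[ℂ] ℂ) (Polynomial.divX^[i] (e c : Polynomial ℂ))) : Polynomial ℂ →ₗ[ℂ] Polynomial ℂ) (LinearMap.proj c : (Fin r → Polynomial ℂ) →ₗ[ℂ] Polynomial ℂ)) ⊓ (Submodule.pi Set.univ (fun _ : Fin r => Polynomial.degreeLT ℂ (w + 1)) : Submodule ℂ (Fin r → Polynomial ℂ))), ∃ b : Fin r, α b ∉ (Submodule.map (LinearMap.mulLeft ℂ (g : Polynomial ℂ)) (Polynomial.degreeLT ℂ (s))) := by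
      by_contra hall
      push Not at hall
      have hle : (⨆ b : Fin r, Submodule.map (LinearMap.proj b : (Fin r → Polynomial ℂ) →ₗ[ℂ] Polynomial ℂ) (LinearMap.ker (∑ c : Fin r, LinearMap.comp (Polynomial.lsum (fun (i : ℕ) => LinearMap.smulRight (LinearMap.id : ℂ →ₗ[ℂ] ℂ) (Polynomial.divX^[i] (e c : Polynomial ℂ))) : Polynomial ℂ →ₗ[ℂ] Polynomial ℂ) (LinearMap.proj c : (Fin r → Polynomial ℂ) →ₗ[ℂ] Polynomial ℂ)) ⊓ (Submodule.pi Set.univ (fun _ : Fin r => Polynomial.degreeLT ℂ (w + 1)) : Submodule ℂ (Fin r → Polynomial ℂ)))) ≤ (Submodule.map (LinearMap.mulLeft ℂ (g : Polynomial ℂ)) (Polynomial.degreeLT ℂ (s))) := by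
        apply iSup_le
        intro b
        rintro x ⟨α, hα, rfl⟩
        exact hall α hα b
      have := Submodule.finrank_mono (hSw ▸ hle : (⨆ b : Fin r, Submodule.map (LinearMap.proj b : (Fin r → Polynomial ℂ) →ₗ[ℂ] Polynomial ℂ) (LinearMap.ker (∑ c : Fin r, LinearMap.comp (Polynomial.lsum (fun (i : ℕ) => LinearMap.smulRight (LinearMap.id : ℂ →ₗ[ℂ] ℂ) (Polynomial.divX^[i] (e c : Polynomial ℂ))) : Polynomial ℂ →ₗ[ℂ] Polynomial ℂ) (LinearMap.proj c : (Fin r → Polynomial ℂ) →ₗ[ℂ] Polynomial ℂ)) ⊓ (Submodule.pi Set.univ (fun _ : Fin r => Polynomial.degreeLT ℂ (w + 1)) : Submodule ℂ (Fin r → Polynomial ℂ)))) ≤ (⨆ b : Fin r, Submodule.map (LinearMap.proj b : (Fin r → Polynomial ℂ) →ₗ[ℂ] Polynomial ℂ) (LinearMap.ker (∑ c : Fin r, LinearMap.comp (Polynomial.lsum (fun (i : ℕ) => LinearMap.smulRight (LinearMap.id : ℂ →ₗ[ℂ] ℂ) (Polynomial.divX^[i] (e c : Polynomial ℂ))) :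 Polynomial ℂ →ₗ[ℂ] Polynomial ℂ) (LinearMap.proj c : (Fin r → Polynomial ℂ) →ₗ[ℂ] Polynomial ℂ)) ⊓ (Submodule.pi Set.univ (fun _ : Fin r => Polynomial.degreeLT ℂ (w)) : Submodule ℂ (Fin r → Polynomial ℂ)))))
      omega
    obtain ⟨α, hα, b, hb⟩ := hex
    have hαb : α b ∈ (Submodule.map (LinearMap.mulLeft ℂ (g : Polynomial ℂ)) (Polynomial.degreeLT ℂ (s + 1))) := by rw [← hSw1]; exact hclR_comp_mem_SL e (w + 1) α hα b
    obtain ⟨q, hq, hqe⟩ := Submodule.mem_map.mp hαb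
    simp only [LinearMap.mulLeft_apply] at hqe
    -- q has natDegree exactly s
    have hq0 : q ≠ 0 := by
      rintro rfl
      apply hb
      rw [← hqe, mul_zero]
      exact Submodule.zero_mem _
    have hqs : q.natDegree = s := by
      have h1 : q.natDegree < s + 1 := by
        rcases (hclR_mem_degreeLT_iff' q (s + 1)).mp hq with h | h
        · exact absurd h hq0
        · exact h
      have h2 : ¬ q.natDegree < s := by
        intro h
        apply hb
        rw [← hqe]
        exact (hclR_mul_mem_VgL_iff g hg0 q s).mpr ((hclR_mem_degreeLT_iff' q s).mpr (Or.inr h))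
      omega
    -- X • α is again a relation in Rel_{w+1}
    have hXα : (fun c => X * α c) ∈ (LinearMap.ker (∑ c : Fin r, LinearMap.comp (Polynomial.lsum (fun (i : ℕ) => LinearMap.smulRight (LinearMap.id : ℂ →ₗ[ℂ] ℂ) (Polynomial.divX^[i] (e c : Polynomial ℂ))) : Polynomial ℂ →ₗ[ℂ] Polynomial ℂ) (LinearMap.proj c : (Fin r → Polynomial ℂ) →ₗ[ℂ] Polynomial ℂ)) ⊓ (Submodule.pi Set.univ (fun _ : Fin r => Polynomial.degreeLT ℂ (w + 1)) : Submodule ℂ (Fin r → Polynomial ℂ))) := by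
      have h1 := hclR_RelL_X_mul e (w + 1) α hα
      obtain ⟨hker, -⟩ := Submodule.mem_inf.mp h1
      refine Submodule.mem_inf.mpr ⟨hker, ?_⟩
      rw [Submodule.mem_pi]
      intro c _
      have hc : α c ∈ (Submodule.map (LinearMap.mulLeft ℂ (g : Polynomial ℂ)) (Polynomial.degreeLT ℂ (s + 1))) := by rw [← hSw1]; exact hclR_comp_mem_SL e (w + 1) α hα c
      rw [hclR_mem_degreeLT_iff']
      by_cases hc0 : α c = 0
      · left; simp [hc0]
      · right
        have := hclR_natDegree_lt_of_mem_VgL g hg0 (α c) (s + 1) hc hc0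
        rw [Polynomial.natDegree_X_mul hc0]
        omega
    -- but its `b` component has degree γ + s + 1, too large for g • V_{s+1}
    have hXb : X * α b ∈ (Submodule.map (LinearMap.mulLeft ℂ (g : Polynomial ℂ)) (Polynomial.degreeLT ℂ (s + 1))) := by
      rw [← hSw1]; exact hclR_comp_mem_SL e (w + 1) _ hXα b
    rw [← hqe, show X * (g * q) = g * (X * q) by ring, hclR_mul_mem_VgL_iff g hg0] at hXb
    rcases (hclR_mem_degreeLT_iff' _ _).mp hXb with h | h
    · exact (mul_ne_zero Polynomial.X_ne_zero hq0) h
    · rw [Polynomial.natDegree_X_mul hq0] at h; omega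
  -- Step 4: the dimension chain
  have hγpos : 1 ≤ γ := by omega
  have ha := hclR_chain_a' e v (w + 1)                       -- D_{w+1}(e') ≤ D_{w+1}(e) + v
  have hb := hclR_relrank_secant ((fun c : Fin r => Polynomial.divX^[(g : Polynomial ℂ).natTrailingDegree] ((e : Fin r → Polynomial ℂ) c))) s γ             -- (1+γ) D'_{s+1} ≤ D'_{s+1+γ} + γ D'_s
  have hsw : s + 1 + γ = w + 1 := by omega
  rw [hsw] at hb
  have hchain : Module.finrank ℂ ↥((LinearMap.ker (∑ c : Fin r, LinearMap.comp (Polynomial.lsum (fun (i : ℕ) => LinearMap.smulRight (LinearMap.id : ℂ →ₗ[ℂ] ℂ) (Polynomial.divX^[i] (e c : Polynomial ℂ))) : Polynomial ℂ →ₗ[ℂ] Polynomial ℂ) (LinearMap.proj c : (Fin r → Polynomial ℂ) →ₗ[ℂ] Polynomial ℂ)) ⊓ (Submodule.pi Set.univ (fun _ : Fin r => Polynomial.degreeLT ℂ (w + 1)) : Submodule ℂ (Fin r → Polynomial ℂ)))) ≤ Module.finrank ℂ ↥((LinearMap.ker (∑ c : Fin r, LinearMap.comp (Polynomial.lsum (fun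 (i : ℕ) => LinearMap.smulRight (LinearMap.id : ℂ →ₗ[ℂ] ℂ) (Polynomial.divX^[i] (e c : Polynomial ℂ))) : Polynomial ℂ →ₗ[ℂ] Polynomial ℂ) (LinearMap.proj c : (Fin r → Polynomial ℂ) →ₗ[ℂ] Polynomial ℂ)) ⊓ (Submodule.pi Set.univ (fun _ : Fin r => Polynomial.degreeLT ℂ (w)) : Submodule ℂ (Fin r → Polynomial ℂ)))) + 1 := by
    rw [hD1, hD0]
    rw [hD1] at ha
    -- γ · D'_{s+1} ≤ γ + γ · D'_s
    have key : γ * Module.finrank ℂ ↥((LinearMap.ker (∑ c : Fin r, LinearMap.comp (Polynomial.lsum (fun (i : ℕ) => LinearMap.smulRight (LinearMap.id : ℂ →ₗ[ℂ] ℂ) (Polynomial.divX^[i] ((fun c : Fin r => Polynomial.divX^[(g : Polynomial ℂ).natTrailingDegree] ((e : Fin r → Polynomial ℂ) c)) c : Polynomial ℂ))) : Polynomial ℂ →ₗ[ℂ] Polynomial ℂ) (LinearMap.proj c : (Fin r → Polynomial ℂ) →ₗ[ℂ] Polynomial ℂ)) ⊓ (Submodule.pi Set.univ (fun _ : Fin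 r => Polynomial.degreeLT ℂ (s + 1)) : Submodule ℂ (Fin r → Polynomial ℂ)))) ≤
        γ * Module.finrank ℂ ↥((LinearMap.ker (∑ c : Fin r, LinearMap.comp (Polynomial.lsum (fun (i : ℕ) => LinearMap.smulRight (LinearMap.id : ℂ →ₗ[ℂ] ℂ) (Polynomial.divX^[i] ((fun c : Fin r => Polynomial.divX^[(g : Polynomial ℂ).natTrailingDegree] ((e : Fin r → Polynomial ℂ) c)) c : Polynomial ℂ))) : Polynomial ℂ →ₗ[ℂ] Polynomial ℂ) (LinearMap.proj c : (Fin r → Polynomial ℂ) →ₗ[ℂ] Polynomial ℂ)) ⊓ (Submodule.pi Set.univ (fun _ : Fin r => Polynomial.degreeLT ℂ (s)) : Submodule ℂ (Fin r → Polynomial ℂ)))) + γ := by nlinarith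
    have := Nat.le_of_mul_le_mul_left (by nlinarith : γ * Module.finrank ℂ ↥((LinearMap.ker (∑ c : Fin r, LinearMap.comp (Polynomial.lsum (fun (i : ℕ) => LinearMap.smulRight (LinearMap.id : ℂ →ₗ[ℂ] ℂ) (Polynomial.divX^[i] ((fun c : Fin r => Polynomial.divX^[(g : Polynomial ℂ).natTrailingDegree] ((e : Fin r → Polynomial ℂ) c)) c : Polynomial ℂ))) : Polynomial ℂ →ₗ[ℂ] Polynomial ℂ) (LinearMap.proj c : (Fin r → Polynomial ℂ) →ₗ[ℂ] Polynomial ℂ)) ⊓ (Submodule.pi Set.univ (fun _ : Fin r => Polynomial.degreeLT ℂ (s + 1)) : Submodule ℂ (Fin r → Polynomial ℂ)))) ≤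
      γ * (Module.finrank ℂ ↥((LinearMap.ker (∑ c : Fin r, LinearMap.comp (Polynomial.lsum (fun (i : ℕ) => LinearMap.smulRight (LinearMap.id : ℂ →ₗ[ℂ] ℂ) (Polynomial.divX^[i] ((fun c : Fin r => Polynomial.divX^[(g : Polynomial ℂ).natTrailingDegree] ((e : Fin r → Polynomial ℂ) c)) c : Polynomial ℂ))) : Polynomial ℂ →ₗ[ℂ] Polynomial ℂ) (LinearMap.proj c : (Fin r → Polynomial ℂ) →ₗ[ℂ] Polynomial ℂ)) ⊓ (Submodule.pi Set.univ (fun _ : Fin r => Polynomial.degreeLT ℂ (s)) : Submodule ℂ (Fin r → Polynomial ℂ)))) + 1)) hγpos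
    exact this
  -- Step 5: rank–nullity
  have h1 := hclR_finrank_RelL_add_KryL e w
  have h2 := hclR_finrank_RelL_add_KryL e (w + 1)
  rw [Nat.mul_succ] at h2
  omega

set_option linter.unusedVariables false in
/-- **(PS) — registered form** (binders `hr`, `he` are part of the registered signature and unused:
the step lemma holds for every frame). -/
theorem hclR_step_lemma : ∀ {r : ℕ} (e : Fin r → Polynomial ℂ) (hr : 2 ≤ r) (he : LinearIndependent ℂ e) (w : ℕ) (hlevel : Module.finrank ℂ ↥((⨆ b : Fin r, Submodule.map (LinearMap.proj b : (Fin r → Polynomial ℂ) →ₗ[ℂ] Polynomial ℂ) (LinearMap.ker (∑ c : Fin r, LinearMap.comp (Polynomial.lsum (fun (i : ℕ) => LinearMap.smulRight (LinearMap.id : ℂ →ₗ[ℂ] ℂ) (Polynomial.divX^[i] (e c : Polynomial ℂ))) : Polynomial ℂ →ₗ[ℂ] Polynomial ℂ) (LinearMap.proj c : (Fin r → Polynomial ℂ) →ₗ[ℂ] Polynomial ℂ)) ⊓ (Submodule.pi Set.univ (fun _ : Fin r => Polynomial.degreeLT ℂ (w + 1)) : Submodule ℂ (Fin r → Polynomial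 ℂ))))) = Module.finrank ℂ ↥((⨆ b : Fin r, Submodule.map (LinearMap.proj b : (Fin r → Polynomial ℂ) →ₗ[ℂ] Polynomial ℂ) (LinearMap.ker (∑ c : Fin r, LinearMap.comp (Polynomial.lsum (fun (i : ℕ) => LinearMap.smulRight (LinearMap.id : ℂ →ₗ[ℂ] ℂ) (Polynomial.divX^[i] (e c : Polynomial ℂ))) : Polynomial ℂ →ₗ[ℂ] Polynomial ℂ) (LinearMap.proj c : (Fin r → Polynomial ℂ) →ₗ[ℂ] Polynomial ℂ)) ⊓ (Submodule.pi Set.univ (fun _ : Fin r => Polynomial.degreeLT ℂ (w)) : Submodule ℂ (Fin r → Polynomial ℂ))))) + 1) (hpos : Module.finrank ℂ ↥((⨆ b : Fin r, Submodule.map (LinearMap.proj b : (Fin r → Polynomial ℂ) →ₗ[ℂ] Polynomial ℂ) (LinearMap.ker (∑ c : Fin r, LinearMap.comp (Polynomial.lsum (fun (i : ℕ) => LinearMap.smulRight (LinearMap.id : ℂ →ₗ[ℂ] ℂ) (Polynomial.divX^[i] (e c : Polynomial ℂ))) : Polynomial ℂ →ₗ[ℂ] Polynomial ℂ) (LinearMap.proj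 c : (Fin r → Polynomial ℂ) →ₗ[ℂ] Polynomial ℂ)) ⊓ (Submodule.pi Set.univ (fun _ : Fin r => Polynomial.degreeLT ℂ (w)) : Submodule ℂ (Fin r → Polynomial ℂ))))) < w), Module.finrank ℂ ↥((Submodule.span ℂ (Set.range (fun p : Fin (r) × Fin (w) => Polynomial.divX^[(Prod.snd p).val] ((e : Fin r → Polynomial ℂ) (Prod.fst p)))))) + r ≤ Module.finrank ℂ ↥((Submodule.span ℂ (Set.range (fun p : Fin (r) × Fin (w + 1) => Polynomial.divX^[(Prod.snd p).val] ((e : Fin r → Polynomial ℂ) (Prod.fst p)))))) + 1 := by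
  intro r e _hr _he w hlevel hpos
  exact hclR_step_lemma' e w hlevel hpos

end PS

end Summit.MatrixMultiplication.MatrixMultiplication.Theorems
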